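import Summits.QuantumFields.BalabanUV.InfraRed.StrongCouplingStaggerForest
import HarnessLib

/-!
# Strong-coupling front, gen-14 combinatorics (W4, two weight classes): the staggered forest has WEIGHTED row
constant `ρ` whenever `14 + t ≤ ρ` and `12 ≤ ρ t` — observatory of the non-perturbative crossover; no mass-gap claim

IR-3 v2 TWO-FRONT CROSSOVER LEDGER, front SC (`β₀`), currency SC-b, `SU(2)`, `d = 4`.
ABSOLUTE RULE of this package: No internally-minted statement may enter as a cited fact. Every hypothesis is either
kernel-proved in this package or a verbatim quotation of a PUBLISHED theorem with page reference. The manuscript(s)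
under audit are NOT citable for their own disputed steps — they are the thing under adjudication; programme-internal
(2001/route/tribunal) claims are never citable.  Nothing is cited as a hypothesis in this file: finite combinatorics.

## What this file proves

With the link weights `stagWeight t` (`t` on time-like links, `1` on space-like links, `0 ≤ t ≤ 1`) the staggered temporal
forest `staggerForest L` (`L ≥ 4`) of `StrongCouplingForestGauge` has weighted influence rows
`∑_{y ∉ F} n(e,y) w(y) ≤ 14 + t` at every space-like link (`w = 1`; the tree's count `15` weighs the one possibly
dynamic time-like staple link by `t`) and `≤ 12` at every dynamic time-like link (`w = t`; all six plaquettes through it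
have exactly their two space-like staple links dynamic).  Hence the weighted row inequality
`∑_{y ∉ F} n(e,y) w(y) ≤ ρ w(e)` for every `ρ` with `14 + t ≤ ρ` and `12 ≤ ρ t` (`weightedRow_stagger_le`); the optimum
`t = (√244 − 14)/2`, `ρ = 7 + √61 = 14.81…` replaces the unweighted row bound `15` in the forest Dobrushin door
(SC-b supremum `4/ρ`; the door itself is `StrongCouplingWeightedForestDoor`, the numbers `StrongCouplingWeightedFront`).
Generic tools: the weighted row `weightedRow F v e` (a definition), its per-plaquette slot form
(`weightedRow_le_sum_slotSum`) and the weighted witness split (`weightedRow_le_of_witness`).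

NOT CLAIMED: any number of the ledger; no mass-gap claim.
-/

noncomputable section

open Finset
open Literature.MathematicalPhysics.QuantumFieldTheory
open Literature.MathematicalPhysics.QuantumFieldTheory.Balaban1983to89
open Literature.MathematicalPhysics.QuantumFieldTheory.Balaban1983to89.StrongCouplingTorusWindow
open Summit.QuantumFields.BalabanUV.InfraRed.StrongCouplingForestGauge
open Summit.QuantumFields.BalabanUV.InfraRed.StrongCouplingStaggerForest

namespace Summit.QuantumFields.BalabanUV.InfraRed.StrongCouplingStaggerWeights

/-! ## 1. Weighted rows, plaquette by plaquette (any dimension) -/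

section Slots

variable {d L : ℕ} [NeZero L]

/-- The **weighted free staple slots** of the plaquette `q` seen from the link `e`: the total weight of those of its
three staple links that are not frozen. [folklore] -/
def slotSum (F : Finset (Edge d L)) (v : Edge d L → ℝ) (e : Edge d L) (q : Plaquette d L) : ℝ :=
  ∑ k : Fin 3, if tstapleLinks q e k ∉ F then v (tstapleLinks q e k) else 0

omit [NeZero L] in
/-- The weighted free slots, slot by slot. [folklore] -/
theorem slotSum_eq (F : Finset (Edge d L)) (v : Edge d L → ℝ) (e : Edge d L) (q : Plaquette d L) :
    slotSum F v e q = (if tstapleLinks q e 0 ∉ F then v (tstapleLinks q e 0) else 0) +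
      (if tstapleLinks q e 1 ∉ F then v (tstapleLinks q e 1) else 0) +
        (if tstapleLinks q e 2 ∉ F then v (tstapleLinks q e 2) else 0) := by
  rw [slotSum, Fin.sum_univ_three]

omit [NeZero L] in
/-- With weights in `[0, vmax]` a plaquette carries weighted free slots `≤ 3 vmax`. [folklore] -/
theorem slotSum_le (F : Finset (Edge d L)) {v : Edge d L → ℝ} {vmax : ℝ} (h0 : 0 ≤ vmax)
    (hv : ∀ y, v y ≤ vmax) (e : Edge d L) (q : Plaquette d L) : slotSum F v e q ≤ 3 * vmax := by
  have hk : ∀ k : Fin 3, (if tstapleLinks q e k ∉ F then v (tstapleLinks q e k) else 0) ≤ vmax := by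
    intro k
    split_ifs <;> first | exact hv _ | exact h0
  rw [slotSum_eq]
  linarith [hk 0, hk 1, hk 2]

omit [NeZero L] in
/-- Weighted free slots are nonnegative for nonnegative weights. [folklore] -/
theorem slotSum_nonneg (F : Finset (Edge d L)) {v : Edge d L → ℝ} (hv : ∀ y, 0 ≤ v y) (e : Edge d L)
    (q : Plaquette d L) : 0 ≤ slotSum F v e q :=
  sum_nonneg fun k _ => by split_ifs <;> first | exact hv _ | exact le_rfl

/-- The **weighted influence row** of the dynamic link `e` outside the frozen set `F`: `∑_{y ∉ F} n(e,y) v(y)` (the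
quantity bounded by `ρ v(e)` in `WeightedForestRowBound`; with unit weights, the cast of `forestRow F e`). [folklore] -/
def weightedRow (F : Finset (Edge d L)) (v : Edge d L → ℝ) (e : Edge d L) : ℝ :=
  ∑ y ∈ linkNbrT e, (if y ∈ F then 0 else (tInfluence e y : ℝ) * v y)

/-- **Per-plaquette form of the weighted row**: `∑_{y ∉ F} n(e,y) v(y) ≤ ∑_{q ∋ e} slotSum q` (nonnegative weights;
the weighted twin of `forestRow_le_sum_freeSlots`). [folklore] -/
theorem weightedRow_le_sum_slotSum (F : Finset (Edge d L)) {v : Edge d L → ℝ} (hv : ∀ y, 0 ≤ v y) (e : Edge d L) :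
    weightedRow F v e ≤ ∑ q ∈ plaqsThrough e, slotSum F v e q := by
  classical
  unfold weightedRow
  calc ∑ y ∈ linkNbrT e, (if y ∈ F then 0 else (tInfluence e y : ℝ) * v y)
      = ∑ y ∈ linkNbrT e, ∑ q ∈ plaqsThrough e, ∑ k : Fin 3,
          (if tstapleLinks q e k = y then (if y ∉ F then v y else 0) else 0) := by
        refine sum_congr rfl fun y _ => ?_
        by_cases hy : y ∈ F
        · simp [hy]
        · rw [if_neg hy]
          simp only [hy, not_false_eq_true, if_true]
          unfold tInfluence
          push_cast
          rw [sum_mul]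
          refine sum_congr rfl fun q _ => ?_
          rw [sum_mul]
          refine sum_congr rfl fun k _ => ?_
          split_ifs <;> simp
    _ = ∑ q ∈ plaqsThrough e, ∑ k : Fin 3, ∑ y ∈ linkNbrT e,
          (if tstapleLinks q e k = y then (if y ∉ F then v y else 0) else 0) := by
        rw [sum_comm]
        exact sum_congr rfl fun q _ => sum_comm
    _ ≤ ∑ q ∈ plaqsThrough e, slotSum F v e q := by
        refine sum_le_sum fun q _ => sum_le_sum fun k _ => ?_
        rw [sum_ite_eq]
        split_ifs <;> first | exact le_rfl | exact hv _

/-- **Weighted witness split**: along a set `Q` of plaquettes through `e`, with weights in `[0, vmax]`,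
`∑_{y ∉ F} n(e,y) v(y) ≤ ∑_{q ∈ Q} slotSum q + 3 vmax (#{q ∋ e} − |Q|)`. [folklore] -/
theorem weightedRow_le_of_witness (F : Finset (Edge d L)) {v : Edge d L → ℝ} {vmax : ℝ} (hv : ∀ y, 0 ≤ v y)
    (h0 : 0 ≤ vmax) (hv1 : ∀ y, v y ≤ vmax) (e : Edge d L) {Q : Finset (Plaquette d L)}
    (hQ : Q ⊆ plaqsThrough e) :
    weightedRow F v e ≤ ∑ q ∈ Q, slotSum F v e q + 3 * vmax * (((plaqsThrough e).card : ℝ) - Q.card) := by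
  classical
  have hsplit := sum_sdiff hQ (f := slotSum F v e)
  have hcard : (((plaqsThrough e \ Q).card : ℕ) : ℝ) = ((plaqsThrough e).card : ℝ) - Q.card := by
    have h := card_sdiff_add_card_eq_card hQ
    have h' : (((plaqsThrough e \ Q).card : ℕ) : ℝ) + (Q.card : ℝ) = (plaqsThrough e).card := by exact_mod_cast h
    linarith
  have hrest : ∑ q ∈ plaqsThrough e \ Q, slotSum F v e q ≤ 3 * vmax * (((plaqsThrough e).card : ℝ) - Q.card) :=
    calc ∑ q ∈ plaqsThrough e \ Q, slotSum F v e q ≤ ∑ _q ∈ plaqsThrough e \ Q, 3 * vmax :=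
          sum_le_sum fun q _ => slotSum_le F h0 hv1 e q
      _ = 3 * vmax * (((plaqsThrough e).card : ℝ) - Q.card) := by rw [sum_const, nsmul_eq_mul, ← hcard, mul_comm]
  linarith [weightedRow_le_sum_slotSum F hv e, hsplit, hrest]

end Slots

/-! ## 2. The two-class weights of the staggered forest -/

section Stagger

variable {L : ℕ} [NeZero L]

/-- The **two-class link weights**: `t` on time-like links, `1` on space-like links. [folklore] -/
def stagWeight (t : ℝ) (e : Edge 4 L) : ℝ := if e.2 = 3 then t else 1

omit [NeZero L] in
/-- Space-like links weigh `1`. [folklore] -/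
theorem stagWeight_spatial (t : ℝ) (x : Site 4 L) {i : Fin 4} (hi : i ≠ 3) : stagWeight t (x, i) = 1 := by
  simp [stagWeight, hi]

omit [NeZero L] in
/-- Time-like links weigh `t`. [folklore] -/
theorem stagWeight_temporal (t : ℝ) (x : Site 4 L) : stagWeight t (x, (3 : Fin 4)) = t := by
  simp [stagWeight]

omit [NeZero L] in
/-- The two-class weights lie in `[min t 1, max t 1]`; for `0 ≤ t ≤ 1`, in `[t, 1]`. [folklore] -/
theorem stagWeight_mem {t : ℝ} (ht0 : 0 ≤ t) (ht1 : t ≤ 1) (e : Edge 4 L) :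
    t ≤ stagWeight t e ∧ stagWeight t e ≤ 1 ∧ 0 ≤ stagWeight t e := by
  unfold stagWeight
  split_ifs
  · exact ⟨le_rfl, ht1, ht0⟩
  · exact ⟨ht1, le_rfl, zero_le_one⟩

omit [NeZero L] in
/-- The staple links of a plaquette seen from its second link. [folklore] -/
theorem tstapleLinks_tLink2 {d : ℕ} (q : Plaquette d L) :
    tstapleLinks q (tLink2 q) = ![tLink3 q, tLink4 q, tLink1 q] := by
  have h1 : tLink2 q ≠ tLink1 q := (tLink1_ne_tLink2 q).symm
  simp [tstapleLinks, h1]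

omit [NeZero L] in
/-- At most one of four mutually exclusive residue conditions holds, weighted form: the four indicators of weight
`t ≥ 0` sum to `≤ t`. [folklore] -/
theorem indicator_four_le_weight (hL : 4 ≤ L) {t : ℝ} (ht : 0 ≤ t) (a : ZMod L) :
    (if a = 2 then t else 0) + (if a = 0 then t else 0) + ((if a = 3 then t else 0) + (if a = 1 then t else 0)) ≤
      t := by
  obtain ⟨h01, h02, h03, h12, h13, h23⟩ := zmod_small_ne hL
  by_cases h0 : a = 0
  · subst h0; simp [h01, h02, h03]
  by_cases h1 : a = 1
  · subst h1; simp [h01.symm, h12, h13]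
  by_cases h2 : a = 2
  · subst h2; simp [h02.symm, h12.symm, h23]
  by_cases h3 : a = 3
  · subst h3; simp [h03.symm, h13.symm, h23.symm]
  simp [h0, h1, h2, h3, ht]

/-- **Space-like links have weighted row `≤ 14 + t`** (`L ≥ 4`, `0 ≤ t ≤ 1`): twelve space-like staple slots on the
four space-like plaquettes (weight `≤ 1` each), the two space-like translates (weight `1`) and at most one dynamic
time-like staple link (weight `t`) on the two time-like plaquettes through `e = (x + e₃, i)`. [folklore] -/
theorem weightedRow_stagger_spatial (hL : 4 ≤ L) {t : ℝ} (ht0 : 0 ≤ t) (ht1 : t ≤ 1) (x : Site 4 L) {i : Fin 4}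
    (hi : i < 3) :
    weightedRow (staggerForest L) (stagWeight t) (x.shift 3, i) ≤ 14 + t := by
  classical
  have hL1 : 1 < L := by omega
  have hi3 : i ≠ 3 := ne_of_lt hi
  set qp : Plaquette 4 L := (x.shift 3, ⟨(i, 3), hi⟩) with hqp
  set qm : Plaquette 4 L := (x, ⟨(i, 3), hi⟩) with hqm
  have hep : (x.shift 3, i) = tLink1 qp := rfl
  have hem : (x.shift 3, i) = tLink3 qm := rfl
  have hne : qp ≠ qm := by
    intro h
    have h1 : x.shift 3 = x := congrArg Prod.fst h
    exact shift_ne_self hL1 x 3 h1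
  have hQ : ({qp, qm} : Finset (Plaquette 4 L)) ⊆ plaqsThrough (x.shift 3, i) := by
    intro q hq
    rcases Finset.mem_insert.1 hq with rfl | hq
    · exact mem_plaqsThrough.2 (by rw [plaqEdgesT_eq, hep]; exact mem_insert_self _ _)
    · rw [Finset.mem_singleton] at hq
      subst hq
      exact mem_plaqsThrough.2 (by
        rw [plaqEdgesT_eq, hem]
        exact mem_insert_of_mem (mem_insert_of_mem (mem_insert_self _ _)))
  have hw := fun e : Edge 4 L => stagWeight_mem ht0 ht1 e
  refine (weightedRow_le_of_witness (staggerForest L) (fun y => (hw y).2.2) zero_le_one (fun y => (hw y).2.1)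
    _ hQ).trans ?_
  rw [sum_pair hne, card_pair hne]
  have h6 : ((plaqsThrough ((x.shift 3, i) : Edge 4 L)).card : ℝ) ≤ 6 := by
    have : (plaqsThrough ((x.shift 3, i) : Edge 4 L)).card ≤ 6 := by simpa using card_plaqsThrough_le (x.shift 3, i)
    exact_mod_cast this
  have sp : tstapleLinks qp (x.shift 3, i) = ![tLink2 qp, tLink3 qp, tLink4 qp] := by
    rw [hep]; exact tstapleLinks_tLink1 qp
  have sm : tstapleLinks qm (x.shift 3, i) = ![tLink2 qm, tLink1 qm, tLink4 qm] := by
    rw [hem]; exact tstapleLinks_tLink3 hL1 qm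
  have e2 : (stagPhase x + 1 - 2 = 1) ↔ stagPhase x = 2 := by
    constructor <;> intro h <;> linear_combination h
  have e0 : (stagPhase x + 1 = 1) ↔ stagPhase x = 0 := by
    constructor <;> intro h <;> linear_combination h
  have e3 : (stagPhase x - 2 = 1) ↔ stagPhase x = 3 := by
    constructor <;> intro h <;> linear_combination h
  have hsum : slotSum (staggerForest L) (stagWeight t) (x.shift 3, i) qp +
      slotSum (staggerForest L) (stagWeight t) (x.shift 3, i) qm ≤ 2 + t := by
    simp only [slotSum_eq, sp, sm, Matrix.cons_val_zero, Matrix.cons_val_one, Matrix.head_cons, Matrix.cons_val_two,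
      Matrix.tail_cons]
    simp only [hqp, hqm, tLink1, tLink2, tLink3, tLink4, temporal_not_mem_staggerForest, stagPhase_shift_ne hi3,
      stagPhase_shift_three, spatial_not_mem_staggerForest hi3, not_false_eq_true, ite_true, e2, e0, e3,
      stagWeight_spatial t _ hi3, stagWeight_temporal]
    have := indicator_four_le_weight hL ht0 (stagPhase x)
    linarith
  push_cast
  nlinarith [hsum, h6]

/-- Space-like links: the weighted row inequality with constant `ρ ≥ 14 + t`. [folklore] -/
theorem weightedRow_stagger_spatial_le (hL : 4 ≤ L) {t ρ : ℝ} (ht0 : 0 ≤ t) (ht1 : t ≤ 1) (hρS : 14 + t ≤ ρ)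
    (x : Site 4 L) {i : Fin 4} (hi : i < 3) :
    weightedRow (staggerForest L) (stagWeight t) (x.shift 3, i) ≤ ρ * stagWeight t (x.shift 3, i) := by
  rw [stagWeight_spatial t _ (ne_of_lt hi), mul_one]
  exact (weightedRow_stagger_spatial hL ht0 ht1 x hi).trans hρS

/-- **Every plaquette through a dynamic time-like link has weighted free slots exactly its two space-like staple
links** (`L ≥ 4`): through `e = (x, 3)` pass only the plaquettes `(x, (j,3))` (`e = tLink4`, time-like staple link
`(x + e_j, 3)` of phase `1 − 2 ≠ 1`, frozen) and `(x − e_j, (j,3))` (`e = tLink2`, time-like staple link `(x − e_j, 3)` of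
phase `1 + 2 ≠ 1`, frozen). [folklore] -/
theorem slotSum_stagger_temporal (hL : 4 ≤ L) (t : ℝ) (x : Site 4 L) (hx : stagPhase x = 1)
    {q : Plaquette 4 L} (hq : q ∈ plaqsThrough ((x, 3) : Edge 4 L)) :
    slotSum (staggerForest L) (stagWeight t) (x, 3) q ≤ 2 := by
  classical
  have hL1 : 1 < L := by omega
  obtain ⟨-, h02, -, -, h13, -⟩ := zmod_small_ne hL
  obtain ⟨z, ⟨⟨μ, ν⟩, hμν⟩⟩ := q
  have hμ3 : μ ≠ 3 := by
    intro h; subst h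
    exact absurd hμν (not_lt.2 (Fin.le_last ν))
  rw [mem_plaqsThrough, plaqEdgesT_eq] at hq
  simp only [Finset.mem_insert, Finset.mem_singleton] at hq
  rcases hq with h | h | h | h
  · exact absurd (congrArg Prod.snd h).symm hμ3
  · -- `e = tLink2 q`: `ν = 3`, `x = z + e_μ`
    have hν : ν = 3 := ((congrArg Prod.snd h).symm : ν = 3)
    subst hν
    have hxz : x = z.shift μ := congrArg Prod.fst h
    have hz : stagPhase z = 3 := by
      have := stagPhase_shift_ne (x := z) hμ3
      rw [← hxz, hx] at this
      linear_combination -this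
    have hno : ¬ stagPhase z = 1 := by rw [hz]; exact fun h' => h13 h'.symm
    have s2 : tstapleLinks ((z, ⟨(μ, 3), hμν⟩) : Plaquette 4 L) (x, 3) =
        ![tLink3 (z, ⟨(μ, 3), hμν⟩), tLink4 (z, ⟨(μ, 3), hμν⟩), tLink1 (z, ⟨(μ, 3), hμν⟩)] := by
      rw [h]; exact tstapleLinks_tLink2 _
    simp only [slotSum_eq, s2, Matrix.cons_val_zero, Matrix.cons_val_one, Matrix.head_cons, Matrix.cons_val_two,
      Matrix.tail_cons]
    simp only [tLink1, tLink3, tLink4, temporal_not_mem_staggerForest, hno, spatial_not_mem_staggerForest hμ3,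
      not_false_eq_true, ite_true, ite_false, stagWeight_spatial t _ hμ3]
    norm_num
  · exact absurd (congrArg Prod.snd h).symm hμ3
  · -- `e = tLink4 q`: `ν = 3`, `z = x`
    have hν : ν = 3 := ((congrArg Prod.snd h).symm : ν = 3)
    subst hν
    have hxz : x = z := congrArg Prod.fst h
    subst hxz
    have hno : ¬ (stagPhase x - 2 = 1) := fun h' => h02 (by rw [hx] at h'; linear_combination h')
    have s4 : tstapleLinks ((x, ⟨(μ, 3), hμν⟩) : Plaquette 4 L) (x, 3) =
        ![tLink3 (x, ⟨(μ, 3), hμν⟩), tLink2 (x, ⟨(μ, 3), hμν⟩), tLink1 (x, ⟨(μ, 3), hμν⟩)] := by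
      rw [h]; exact tstapleLinks_tLink4 hL1 _
    simp only [slotSum_eq, s4, Matrix.cons_val_zero, Matrix.cons_val_one, Matrix.head_cons, Matrix.cons_val_two,
      Matrix.tail_cons]
    simp only [tLink1, tLink2, tLink3, temporal_not_mem_staggerForest, stagPhase_shift_ne hμ3, hno,
      spatial_not_mem_staggerForest hμ3, not_false_eq_true, ite_true, ite_false, stagWeight_spatial t _ hμ3]
    norm_num

/-- **Dynamic time-like links have weighted row `≤ 12`** (`L ≥ 4`): at most six plaquettes, two unit weights each.
[folklore] -/
theorem weightedRow_stagger_temporal (hL : 4 ≤ L) {t : ℝ} (ht0 : 0 ≤ t) (ht1 : t ≤ 1) (x : Site 4 L)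
    (hx : (x, (3 : Fin 4)) ∉ staggerForest L) :
    weightedRow (staggerForest L) (stagWeight t) (x, 3) ≤ 12 := by
  classical
  rw [temporal_not_mem_staggerForest] at hx
  have hw := fun e : Edge 4 L => stagWeight_mem ht0 ht1 e
  refine (weightedRow_le_sum_slotSum (staggerForest L) (fun y => (hw y).2.2) _).trans ?_
  have h6 : ((plaqsThrough ((x, 3) : Edge 4 L)).card : ℝ) ≤ 6 := by
    have : (plaqsThrough ((x, 3) : Edge 4 L)).card ≤ 6 := by simpa using card_plaqsThrough_le ((x, 3) : Edge 4 L)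
    exact_mod_cast this
  calc ∑ q ∈ plaqsThrough ((x, 3) : Edge 4 L), slotSum (staggerForest L) (stagWeight t) (x, 3) q
      ≤ ∑ _q ∈ plaqsThrough ((x, 3) : Edge 4 L), (2 : ℝ) :=
        sum_le_sum fun q hq => slotSum_stagger_temporal hL t x hx hq
    _ ≤ 12 := by rw [sum_const, nsmul_eq_mul]; linarith

/-- Dynamic time-like links: the weighted row inequality with `ρ t ≥ 12`. [folklore] -/
theorem weightedRow_stagger_temporal_le (hL : 4 ≤ L) {t ρ : ℝ} (ht0 : 0 ≤ t) (ht1 : t ≤ 1) (hρT : 12 ≤ ρ * t)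
    (x : Site 4 L) (hx : (x, (3 : Fin 4)) ∉ staggerForest L) :
    weightedRow (staggerForest L) (stagWeight t) (x, 3) ≤ ρ * stagWeight t (x, 3) := by
  rw [stagWeight_temporal]
  exact (weightedRow_stagger_temporal hL ht0 ht1 x hx).trans hρT

/-- **W4 (two classes), per volume**: on every torus of side `L ≥ 4`, with `0 ≤ t ≤ 1`, `14 + t ≤ ρ` and `12 ≤ ρ t`,
the staggered temporal forest satisfies the weighted row inequality `∑_{y ∉ F} n(e,y) w(y) ≤ ρ w(e)` at every
dynamic link for the two-class weights `w = stagWeight t`. [folklore] -/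
theorem weightedRow_stagger_le (hL : 4 ≤ L) {t ρ : ℝ} (ht0 : 0 ≤ t) (ht1 : t ≤ 1) (hρS : 14 + t ≤ ρ)
    (hρT : 12 ≤ ρ * t) (e : Edge 4 L) (he : e ∉ staggerForest L) :
    weightedRow (staggerForest L) (stagWeight t) e ≤ ρ * stagWeight t e := by
  obtain ⟨z, i⟩ := e
  by_cases hi : i = 3
  · subst hi
    exact weightedRow_stagger_temporal_le hL ht0 ht1 hρT z he
  · have hi3 : i < 3 := by
      apply Fin.lt_def.2
      have h1 : (i : ℕ) ≠ 3 := fun h => hi (Fin.ext h)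
      have h2 : (i : ℕ) < 4 := i.isLt
      show (i : ℕ) < 3
      omega
    have hz : (z - Pi.single 3 1 : Site 4 L).shift 3 = z := by
      simp [Site.shift]
    have h := weightedRow_stagger_spatial_le hL ht0 ht1 hρS (z - Pi.single 3 1) hi3
    rw [hz] at h
    exact h

/-- The OPTIMAL two-class constant is `ρ = 7 + √61 = 14.8102…` at `t = (√244 − 14)/2 = 0.8102…`; a rational
instance: `t = 1013/1250`, `ρ = 18513/1250 = 14.8104` (`14 + t = ρ`, `ρ t = 12.0023… ≥ 12`), door supremum
`4/ρ = 5000/18513 = 0.27008…` versus `4/15 = 0.2667`. Arithmetic only. [folklore] -/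
theorem twoClass_constants :
    (14 : ℝ) + 1013 / 1250 ≤ 18513 / 1250 ∧ (12 : ℝ) ≤ 18513 / 1250 * (1013 / 1250) ∧
      (4 : ℝ) / 15 < 4 / (18513 / 1250) ∧ (4 : ℝ) / (18513 / 1250) = 5000 / 18513 ∧
        (0.27 : ℝ) < 5000 / 18513 ∧ (5000 : ℝ) / 18513 < 2 / 7 := by
  norm_num

end Stagger

end Summit.QuantumFields.BalabanUV.InfraRed.StrongCouplingStaggerWeights
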